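import Summits.Ventures.LatticeQCDFlow.Scaling.BooleanWitnessColdStartLaw
import Summits.Ventures.LatticeQCDFlow.Scaling.HalfSwapTightSectorLaw

/-!
HONEST FRAMING: exact (Metropolis-corrected) sampling algorithms for lattice gauge theory; figures
of merit are autocorrelation/cost numbers at stated couplings and volumes; no continuum-physics
claim.

# HalfSwapBooleanStarLaw — THE HALF-SWAP CARD OF THE BOOLEAN STAR (`t = ½`, `w_0 = 1`, EVERY COLD LEVEL LISTED EXACTLY `c` TIMES,
# `m = cK`): `d(n) ≤ (1 + 3K/2)·(1 − a/(6(K+1)))ⁿ`, `t_mix(ε) ≤ ⌈(6(K+1)/a)·log((1 + 3K/2)/ε)⌉`; ON THE WITNESS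
# `(2K/p)·log((K+1)(1−ε−Kθ)) ≤ t_mix(ε) ≤ ⌈(6(K+1)(1−pθ)/(p(1−θ)))·log((1 + 3K/2)/ε)⌉` (lean-2 GEN-30, ours)

Venture-side (OURS).  Cell `lqcd-flow` (pub-lqcd), unit `pub-lqcd-lean-2-g30`, 2026-08-28.  Chapter P (OPEN-MATH-chapterM item 1 on
the two-point family), file 7: the recipe card, in the normalisation of `Scaling/HalfSwapStarRecipe` (N17) and `Scaling/HalfSwapTightSectorLaw`
(O10) — half of the steps are swap attempts, the other half exact hot redraws (`w_0 = 1`: cold replicas move only by swaps), uniform listing.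

## What is proved

* **`halfBoolStar_worstTvDist_le`** — Boolean star (two-point replicas, identity maps, exact hot redraws), acceptance floor `0 ≤ a ≤ 1` between
  unequal contents: **`d(n) ≤ (1 + 3K/2)·(1 − a/(6(K+1)))ⁿ`**.
* **`halfBoolStar_mixingTime_le`** — **`t_mix(ε) ≤ ⌈(6(K+1)/a)·log((1 + 3K/2)/ε)⌉`** (`a > 0`, `ε > 0`).
* **`halfBoolWitness_mixingTime_two_sided`** — on the O4 witness (`μ_k = (θ,1−θ)`, `μ_0 = (pθ,1−pθ)`), with chapter O's floor O8 read at half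
  swaps: **`(2K/p)·log((K+1)(1−ε−Kθ)) ≤ t_mix(ε) ≤ ⌈(6(K+1)(1−pθ)/(p(1−θ)))·log((1 + 3K/2)/ε)⌉`** (`K ≥ 1`, `0 < ε`, `ε + Kθ < 1`).

Reading (no numerics implied): at half swaps the persistent hub on `K` two-point replicas of quality `p` mixes from the worst start in between
`(2K/p)·log K` and `≈ (6K/p)·log(K/ε)` steps — `Θ((K/p) log K)`, the constants `2` and `6(1−pθ)/(1−θ)` apart, nothing of `log(1/θ)`:
chapter O's half-swap card (O10: gap, relaxation, autocorrelation, linear term and `log K` floors, all in `1/p`) is completed by the matching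
cold-start ceiling on the witness.  NOT CLAIMED: general `S`; anything measured.  Literature grade (cell rule): OWN COMPOSITION (P4, P5, O8);
nothing cited as a fact; no new bib keys.
-/

noncomputable section

open Finset Function
open Literature.Probability.MarkovChains

namespace Summit.Ventures.LatticeQCDFlow.Scaling

variable {K m : ℕ} {μ : Fin (K + 1) → Bool → ℝ} {M : Fin (K + 1) → Bool → Bool → ℝ} {w : Fin (K + 1) → ℝ} {p θ : ℝ}

section HalfSwap
variable (κ : Fin m → Fin K)

/-- The half-swap constants: `t = ½`, `w_0 = 1`, `m = cK` give rate `≥ a/(6(K+1))` and prefactor `1 + 3K/2` (`0 ≤ a ≤ 1`, `K, c ≥ 1`). [ours] -/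
theorem halfBoolStar_constants (hK : 1 ≤ K) {c : ℕ} (hc1 : 1 ≤ c) (hmR : (m : ℝ) = c * K) (hw01 : w 0 = 1) {a : ℝ} (ha0 : 0 ≤ a)
    (ha1 : a ≤ 1) :
    a / (6 * (K + 1)) ≤ (1 / 2 : ℝ) * ((1 - 1 / 2) * w 0) / (2 * (1 / 2) + (1 - 1 / 2) * w 0) * min (a * c / m) (1 / (K + 1))
      ∧ (1 : ℝ) + K * (2 * (1 / 2) + (1 - 1 / 2) * w 0) / (2 * (1 / 2)) = 1 + 3 * K / 2
      ∧ (1 / 2 : ℝ) * ((1 - 1 / 2) * w 0) / (2 * (1 / 2) + (1 - 1 / 2) * w 0) * min (a * c / m) (1 / (K + 1)) ≤ 1 := by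
  have hKpos : (0 : ℝ) < K := Nat.cast_pos.mpr (by omega)
  have hcpos : (0 : ℝ) < c := Nat.cast_pos.mpr (by omega)
  rw [hw01, hmR]
  have hrate : (1 / 2 : ℝ) * ((1 - 1 / 2) * 1) / (2 * (1 / 2) + (1 - 1 / 2) * 1) = 1 / 6 := by norm_num
  rw [hrate]
  have hacm : a * c / (c * K) = a / K := by field_simp
  rw [hacm]
  refine ⟨?_, by ring, ?_⟩
  · have hmin : a / (K + 1) ≤ min (a / K) (1 / (K + 1)) := by
      refine le_min ?_ ?_
      · exact div_le_div_of_nonneg_left ha0 hKpos (by linarith)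
      · exact div_le_div_of_nonneg_right ha1 (by positivity)
    calc a / (6 * (K + 1)) = 1 / 6 * (a / (K + 1)) := by field_simp
      _ ≤ 1 / 6 * min (a / K) (1 / (K + 1)) := by gcongr
  · have : min (a / (K : ℝ)) (1 / (K + 1)) ≤ 1 := (min_le_right _ _).trans (by rw [div_le_one (by positivity)]; linarith)
    have h0 : 0 ≤ min (a / (K : ℝ)) (1 / (K + 1)) := le_min (by positivity) (by positivity)
    nlinarith

/-- **THE HALF-SWAP COLD-START LAW OF THE BOOLEAN STAR:** `d(n) ≤ (1 + 3K/2)·(1 − a/(6(K+1)))ⁿ` (two-point replicas with positive laws,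
identity maps, every cold level listed exactly `c ≥ 1` times, `m = cK`, `w_0 = 1`, exact hot redraws, `μ_k`-reversible cold kernels,
acceptance floor `0 ≤ a ≤ 1` between unequal contents). [ours] -/
theorem halfBoolStar_worstTvDist_le (hK : 1 ≤ K) {c : ℕ} (hc1 : 1 ≤ c) (hceq : ∀ k : Fin K, (univ.filter (fun r : Fin m => κ r = k)).card = c)
    (hmc : m = c * K) (hw0 : ∀ k, 0 ≤ w k) (hw01 : w 0 = 1) (hw1 : ∑ k, w k = 1) (hμ : ∀ k x, 0 < μ k x) (hμ1 : ∀ k, ∑ u, μ k u = 1)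
    (hM : ∀ k, IsRowStochastic (M k)) (hMrev : ∀ k, DetailedBalance (μ k) (M k)) (hM0 : ∀ u v, M 0 u v = μ 0 v)
    {a : ℝ} (ha0 : 0 ≤ a) (ha1 : a ≤ 1)
    (ha : ∀ (r : Fin m) (z : Fin (K + 1) → Bool), z 0 ≠ z (κ r).succ →
      a ≤ min 1 (tensorFun μ (edgeFlowSwap (Equiv.refl Bool) 0 (κ r).succ z) / tensorFun μ z)) (n : ℕ) :
    worstTvDist (fun y z : Fin (K + 1) → Bool =>
        (1 / 2 : ℝ) * ptGraphSwap μ (fun r : Fin m => (((0 : Fin (K + 1)), (κ r).succ) : Fin (K + 1) × Fin (K + 1)))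
              (fun _ : Fin m => Equiv.refl Bool) y z + (1 - 1 / 2) * prodKernel w M y z) (tensorFun μ) n
      ≤ (1 + 3 * K / 2) * (1 - a / (6 * (K + 1))) ^ n := by
  obtain ⟨hm, hc, hmR⟩ := halfStarUniform_basic κ hK hc1 hceq hmc
  have hw00 : 0 < w 0 := by rw [hw01]; exact one_pos
  obtain ⟨hrate, hconst, hle1⟩ := halfBoolStar_constants (m := m) hK hc1 hmR hw01 ha0 ha1
  have h := boolStar_worstTvDist_le_tuned κ hm (by norm_num : (0 : ℝ) < 1 / 2) (by norm_num) hw0 hw00 hw1 hμ hμ1 hM hMrev hM0 ha0 hc ha n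
  rw [hconst] at h
  refine h.trans (mul_le_mul_of_nonneg_left (pow_le_pow_left₀ (by linarith) (by linarith) n) (by positivity))

/-- **THE HALF-SWAP MIXING TIME OF THE BOOLEAN STAR:** `t_mix(ε) ≤ ⌈(6(K+1)/a)·log((1 + 3K/2)/ε)⌉` (`0 < a ≤ 1`, `ε > 0`). [ours] -/
theorem halfBoolStar_mixingTime_le (hK : 1 ≤ K) {c : ℕ} (hc1 : 1 ≤ c) (hceq : ∀ k : Fin K, (univ.filter (fun r : Fin m => κ r = k)).card = c)
    (hmc : m = c * K) (hw0 : ∀ k, 0 ≤ w k) (hw01 : w 0 = 1) (hw1 : ∑ k, w k = 1) (hμ : ∀ k x, 0 < μ k x) (hμ1 : ∀ k, ∑ u, μ k u = 1)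
    (hM : ∀ k, IsRowStochastic (M k)) (hMrev : ∀ k, DetailedBalance (μ k) (M k)) (hM0 : ∀ u v, M 0 u v = μ 0 v)
    {a : ℝ} (ha0 : 0 < a) (ha1 : a ≤ 1)
    (ha : ∀ (r : Fin m) (z : Fin (K + 1) → Bool), z 0 ≠ z (κ r).succ →
      a ≤ min 1 (tensorFun μ (edgeFlowSwap (Equiv.refl Bool) 0 (κ r).succ z) / tensorFun μ z)) {ε : ℝ} (hε : 0 < ε) :
    mixingTime (fun y z : Fin (K + 1) → Bool =>
        (1 / 2 : ℝ) * ptGraphSwap μ (fun r : Fin m => (((0 : Fin (K + 1)), (κ r).succ) : Fin (K + 1) × Fin (K + 1)))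
              (fun _ : Fin m => Equiv.refl Bool) y z + (1 - 1 / 2) * prodKernel w M y z) (tensorFun μ) ε
      ≤ ⌈6 * (K + 1) / a * Real.log ((1 + 3 * K / 2) / ε)⌉₊ := by
  have hKpos : (0 : ℝ) < K := Nat.cast_pos.mpr (by omega)
  set n : ℕ := ⌈6 * (K + 1) / a * Real.log ((1 + 3 * K / 2) / ε)⌉₊ with hn
  refine mixingTime_le _ _ ((halfBoolStar_worstTvDist_le κ hK hc1 hceq hmc hw0 hw01 hw1 hμ hμ1 hM hMrev hM0 ha0.le ha1 ha n).trans ?_)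
  have hρ0 : 0 < a / (6 * (K + 1)) := by positivity
  have hρ1 : a / (6 * (K + 1)) ≤ 1 := by rw [div_le_one (by positivity)]; linarith
  refine geom_le_of_ge_log hρ0 hρ1 (by positivity) hε ?_
  rw [one_div_div]
  exact Nat.le_ceil _

/-- **THE HALF-SWAP CARD ON THE WITNESS, BOTH SIDES:** `K` cold replicas `(θ,1−θ)`, hot law `(pθ,1−pθ)`, identity maps, exact hot redraws,
idle cold replicas, every cold level listed exactly `c ≥ 1` times, `m = cK`, `w_0 = 1`:
**`(2K/p)·log((K+1)(1−ε−Kθ)) ≤ t_mix(ε) ≤ ⌈(6(K+1)(1−pθ)/(p(1−θ)))·log((1 + 3K/2)/ε)⌉`** (`K ≥ 1`, `0 < p ≤ 1`, `0 < θ < 1`, `0 < ε`,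
`ε + Kθ < 1`) — `Θ((K/p)·log K)` from both sides with nothing of `log(1/θ)`. [ours] -/
theorem halfBoolWitness_mixingTime_two_sided (hK : 1 ≤ K) {c : ℕ} (hc1 : 1 ≤ c)
    (hceq : ∀ k : Fin K, (univ.filter (fun r : Fin m => κ r = k)).card = c) (hmc : m = c * K)
    (hw0 : ∀ k, 0 ≤ w k) (hw01 : w 0 = 1) (hw1 : ∑ k, w k = 1) (hp0 : 0 < p) (hp1 : p ≤ 1) (hθ0 : 0 < θ) (hθ1 : θ < 1)
    {ε : ℝ} (hε0 : 0 < ε) (hε : ε + K * θ < 1) :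
    2 * K / p * Real.log (((K : ℝ) + 1) * (1 - ε - K * θ))
      ≤ (mixingTime (fun a b : Fin (K + 1) → Bool =>
              (1 / 2 : ℝ) * ptGraphSwap (fun (k : Fin (K + 1)) (b : Bool) =>
                    if k = 0 then (if b then p * θ else 1 - p * θ) else (if b then θ else 1 - θ))
                  (fun r : Fin m => (((0 : Fin (K + 1)), (κ r).succ) : Fin (K + 1) × Fin (K + 1)))
                  (fun _ : Fin m => Equiv.refl Bool) a b
                + (1 - 1 / 2) * prodKernel w (fun (k : Fin (K + 1)) (u v : Bool) =>
                    if k = 0 then (if v then p * θ else 1 - p * θ) else (if u = v then (1 : ℝ) else 0)) a b)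
            (tensorFun (fun (k : Fin (K + 1)) (b : Bool) =>
              if k = 0 then (if b then p * θ else 1 - p * θ) else (if b then θ else 1 - θ))) ε : ℝ)
    ∧ mixingTime (fun a b : Fin (K + 1) → Bool =>
              (1 / 2 : ℝ) * ptGraphSwap (fun (k : Fin (K + 1)) (b : Bool) =>
                    if k = 0 then (if b then p * θ else 1 - p * θ) else (if b then θ else 1 - θ))
                  (fun r : Fin m => (((0 : Fin (K + 1)), (κ r).succ) : Fin (K + 1) × Fin (K + 1)))
                  (fun _ : Fin m => Equiv.refl Bool) a b
                + (1 - 1 / 2) * prodKernel w (fun (k : Fin (K + 1)) (u v : Bool) =>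
                    if k = 0 then (if v then p * θ else 1 - p * θ) else (if u = v then (1 : ℝ) else 0)) a b)
            (tensorFun (fun (k : Fin (K + 1)) (b : Bool) =>
              if k = 0 then (if b then p * θ else 1 - p * θ) else (if b then θ else 1 - θ))) ε
      ≤ ⌈6 * (K + 1) / (p * (1 - θ) / (1 - p * θ)) * Real.log ((1 + 3 * K / 2) / ε)⌉₊ := by
  obtain ⟨hm, hc, hmR⟩ := halfStarUniform_basic κ hK hc1 hceq hmc
  have hKpos : (0 : ℝ) < K := Nat.cast_pos.mpr (by omega)
  have hcpos : (0 : ℝ) < c := Nat.cast_pos.mpr (by omega)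
  have hw00 : 0 < w 0 := by rw [hw01]; exact one_pos
  have hpθ1 : p * θ < 1 := by nlinarith
  refine ⟨?_, ?_⟩
  · -- the floor O8 at half swaps and uniform listing: `m/(t·c·p) = 2K/p`
    have h := (boolWitness_mixingTime_two_sided κ hK hm (by norm_num : (0 : ℝ) < 1 / 2) (by norm_num) hw0 hw00 hw1 hp0 hp1 hθ0 hθ1
      hc1 hc (cmax := c) (fun k => (hceq k).le) hε0 hε).1
    have hcoef : (m : ℝ) / (1 / 2 * c * p) = 2 * K / p := by rw [hmR]; field_simp
    rw [hcoef] at h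
    exact h
  · -- the ceiling at half swaps with `a = p(1−θ)/(1−pθ)`
    have hμ : ∀ (k : Fin (K + 1)) (x : Bool), 0 < (fun (k : Fin (K + 1)) (b : Bool) =>
        if k = 0 then (if b then p * θ else 1 - p * θ) else (if b then θ else 1 - θ)) k x := by
      intro k x
      by_cases hk : k = 0
      · simp only [hk, if_true]; split_ifs; exacts [mul_pos hp0 hθ0, by linarith]
      · simp only [hk, if_false]; split_ifs; exacts [hθ0, by linarith]
    have hμ1 : ∀ k : Fin (K + 1), ∑ u, (fun (k : Fin (K + 1)) (b : Bool) =>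
        if k = 0 then (if b then p * θ else 1 - p * θ) else (if b then θ else 1 - θ)) k u = 1 := by
      intro k
      by_cases hk : k = 0
      · simp only [hk, if_true]; exact sum_bool_law _
      · simp only [hk, if_false]; exact sum_bool_law _
    have hM := fun k : Fin (K + 1) => boolWitness_rowStochastic (K := K) hp0.le hp1 hθ0.le hθ1.le k
    have hMrev := fun k : Fin (K + 1) => boolWitness_detailedBalance (K := K) (p := p) (θ := θ) k
    have hM0 : ∀ u v : Bool, (fun (k : Fin (K + 1)) (u v : Bool) =>
        if k = 0 then (if v then p * θ else 1 - p * θ) else (if u = v then (1 : ℝ) else 0)) 0 u v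
        = (fun (k : Fin (K + 1)) (b : Bool) => if k = 0 then (if b then p * θ else 1 - p * θ) else (if b then θ else 1 - θ)) 0 v := by
      intro u v; simp only [if_true]
    have ha0 : 0 < p * (1 - θ) / (1 - p * θ) := div_pos (mul_pos hp0 (by linarith)) (by linarith)
    have ha1 : p * (1 - θ) / (1 - p * θ) ≤ 1 := by rw [div_le_one (by linarith)]; nlinarith
    exact halfBoolStar_mixingTime_le κ hK hc1 hceq hmc hw0 hw01 hw1 hμ hμ1 hM hMrev hM0 ha0 ha1 (boolWitness_accept_ge κ hp0 hp1 hθ0 hθ1) hε0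

end HalfSwap

end Summit.Ventures.LatticeQCDFlow.Scaling

end
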